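import Mathlib
import HarnessLib

/-!
# Crux `NarrowRunsDie` (stmt-ResolutionOfSingularities-16882, route `WildCones`), line `derivlift` —
# stub `stub_dict`

Registered stub of the line skeleton `Cruxes/NarrowRunsDie/Lines/derivlift.lean` (v3), stated over the
route's inlined `let` calculus VERBATIM. See the skeleton docstring of `Sig.stub_dict` for the paper proof.

## The dictionary `sub i τ (Ser a) = X_i^s * Ser (tr i τ s (dv i s (bl i a)))`

Proof by coefficient comparison at `E : Fin n →₀ ℕ` (char-free, any field `κ`, any `s`).

* LHS (`dict_coeff_lhs`): `MvPowerSeries.coeff_subst` expresses the coefficient as a `finsum` over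
  `d : Fin n →₀ ℕ` of `a d • coeff E (∏ j, fam j ^ d j)`; the product is
  `X_i^{|d|} * ∏_{j ≠ i} (X j + C τ_j)^{d j}` (`dict_prod_fam_pow`), whose coefficients are given in
  closed form by `dict_coeff_Xpow_mul_prod` (binomial expansion into monomials and
  `Finset.prod_univ_sum`); the finsum is then a finite sum over the box `{d | ∀ j, d j ≤ E i}`.
* RHS (`dict_rhs`): unfolding the verbatim `tr ∘ dv ∘ bl` sum at the state `B = E - s e_i` and
  cleaning the guards gives a sum over shifts `D`; `dict_reindex` matches it with the LHS sum through
  the bijection `D ↦ Â(D) = update (E + D) i (E i - ∑_{j ≠ i} (E j + D j))` with inverse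
  `d ↦ update (d - E) i 0`.
* If `E i < s` both sides vanish (the LHS by the vanishing hypothesis on `a`).

No auxiliary definitions: the substitution family is written out as the literal `ite` of the `sub` let.
-/

noncomputable section

set_option linter.dupNamespace false

namespace Summit.ResolutionOfSingularities.ResolutionOfSingularities.Theorems.NarrowRunsDie

open MvPowerSeries Finset

variable {n : ℕ} {κ : Type} [Field κ]

/-! ### The substitution family and the LHS coefficient formula -/

/-- Binomial expansion of `(X j + C t) ^ m` as a sum of monomials. -/
theorem dict_X_add_C_pow (j : Fin n) (t : κ) (m : ℕ) :
    (X j + C t : MvPowerSeries (Fin n) κ) ^ m =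
      ∑ k ∈ range (m + 1), monomial (Finsupp.single j k) (((m.choose k : ℕ) : κ) * t ^ (m - k)) := by
  rw [add_pow]
  refine sum_congr rfl (fun k _ => ?_)
  rw [X_pow_eq, ← map_pow, ← map_natCast (C : κ →+* MvPowerSeries (Fin n) κ), mul_assoc, ← map_mul,
    ← monomial_zero_eq_C_apply, monomial_mul_monomial, add_zero, one_mul, mul_comm]

/-- The product of powers of the family: `∏ j, fam j ^ d j = X_i^{|d|} ∏_{j ≠ i} (X j + C τ_j)^{d j}`. -/
theorem dict_prod_fam_pow (i : Fin n) (τ : Fin n → κ) (d : Fin n → ℕ) :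
    ∏ j, (@ite (MvPowerSeries (Fin n) κ) (j = i) (Classical.dec _) (MvPowerSeries.X i)
        (MvPowerSeries.X i * (MvPowerSeries.X j + MvPowerSeries.C (τ j)))) ^ (d j) =
      X i ^ (∑ j, d j) * ∏ j ∈ univ.erase i, (X j + C (τ j)) ^ (d j) := by
  rw [← mul_prod_erase univ _ (mem_univ i), ← add_sum_erase univ _ (mem_univ i), if_pos rfl,
    pow_add, mul_assoc, ← prod_pow_eq_pow_sum, ← prod_mul_distrib]
  congr 1
  refine prod_congr rfl (fun j hj => ?_)
  rw [if_neg (ne_of_mem_erase hj), mul_pow]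

/-- `∑ j, single j (g j)` is the finitely supported function with values `g`. -/
theorem dict_sum_single (g : Fin n → ℕ) :
    ∑ j, Finsupp.single j (g j) = Finsupp.equivFunOnFinite.symm g := by
  have := Finsupp.univ_sum_single (Finsupp.equivFunOnFinite.symm g)
  simpa using this

/-- Closed formula: the coefficient of `u^E` in `X_i^m ∏_{j ≠ i} (X j + C τ_j)^{d j}` is
`[E i = m] ∏_{j ≠ i} [E j ≤ d j] (d j choose E j) τ_j^{d j - E j}`. -/
theorem dict_coeff_Xpow_mul_prod (i : Fin n) (τ : Fin n → κ) (d : Fin n → ℕ) (m : ℕ)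
    (E : Fin n →₀ ℕ) :
    coeff E (X i ^ m * ∏ j ∈ univ.erase i, (X j + C (τ j)) ^ (d j)) =
      if (E i = m ∧ ∀ j ≠ i, E j ≤ d j) then
        ∏ j ∈ univ.erase i, (((d j).choose (E j) : ℕ) : κ) * τ j ^ (d j - E j) else 0 := by
  classical
  have key : X i ^ m * ∏ j ∈ univ.erase i, (X j + C (τ j)) ^ (d j) =
      ∏ j, ∑ k ∈ (if j = i then ({m} : Finset ℕ) else range (d j + 1)),
        monomial (Finsupp.single j k)
          (if j = i then (1 : κ) else (((d j).choose k : ℕ) : κ) * τ j ^ (d j - k)) := by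
    rw [← mul_prod_erase univ _ (mem_univ i)]
    congr 1
    · rw [if_pos rfl, sum_singleton, if_pos rfl, X_pow_eq]
    · refine prod_congr rfl (fun j hj => ?_)
      have hji : j ≠ i := ne_of_mem_erase hj
      simp only [if_neg hji]
      exact dict_X_add_C_pow j (τ j) (d j)
  rw [key, prod_univ_sum, map_sum]
  simp_rw [prod_monomial, dict_sum_single, coeff_monomial, Equiv.eq_symm_apply]
  rw [sum_ite_eq]
  have hE : Finsupp.equivFunOnFinite E = ⇑E := rfl
  rw [hE]
  by_cases h : E i = m ∧ ∀ j ≠ i, E j ≤ d j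
  · rw [if_pos h, if_pos, ← mul_prod_erase univ _ (mem_univ i), if_pos rfl, one_mul]
    · refine prod_congr rfl (fun j hj => ?_)
      rw [if_neg (ne_of_mem_erase hj)]
    · rw [Fintype.mem_piFinset]
      intro j
      by_cases hj : j = i
      · subst hj; rw [if_pos rfl, mem_singleton]; exact h.1
      · rw [if_neg hj, mem_range, Nat.lt_succ_iff]; exact h.2 j hj
  · rw [if_neg h, if_neg]
    intro hmem
    rw [Fintype.mem_piFinset] at hmem
    apply h
    constructor
    · have := hmem i; rw [if_pos rfl, mem_singleton] at this; exact this
    · intro j hj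
      have := hmem j; rw [if_neg hj, mem_range, Nat.lt_succ_iff] at this; exact this

/-- The closed formula, for the `Finsupp.prod` of `MvPowerSeries.coeff_subst`. -/
theorem dict_coeff_prod_fam (i : Fin n) (τ : Fin n → κ) (g : Fin n → ℕ) (E : Fin n →₀ ℕ) :
    coeff E ((Finsupp.equivFunOnFinite.symm g).prod fun j e =>
        (@ite (MvPowerSeries (Fin n) κ) (j = i) (Classical.dec _) (MvPowerSeries.X i)
        (MvPowerSeries.X i * (MvPowerSeries.X j + MvPowerSeries.C (τ j)))) ^ e) =
      if (E i = ∑ j, g j ∧ ∀ j ≠ i, E j ≤ g j) then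
        ∏ j ∈ univ.erase i, (((g j).choose (E j) : ℕ) : κ) * τ j ^ (g j - E j) else 0 := by
  rw [Finsupp.prod_fintype _ _ (fun j => pow_zero _)]
  simp_rw [Finsupp.coe_equivFunOnFinite_symm]
  rw [dict_prod_fam_pow, dict_coeff_Xpow_mul_prod]

/-- **LHS coefficient.** The coefficient of `u^E` in `sub i τ F`, `F = Ser a`, as a finite sum over
the box `{d | ∀ j, d j ≤ E i}` of `a d` times the closed-form weight. -/
theorem dict_coeff_lhs (a : (Fin n → ℕ) → κ) (i : Fin n) (τ : Fin n → κ) (E : Fin n →₀ ℕ)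
    (F : MvPowerSeries (Fin n) κ) (hF : ∀ d, coeff d F = a ⇑d) :
    coeff E (subst (fun j : Fin n => @ite (MvPowerSeries (Fin n) κ) (j = i) (Classical.dec _) (MvPowerSeries.X i)
        (MvPowerSeries.X i * (MvPowerSeries.X j + MvPowerSeries.C (τ j)))) F) =
      ∑ d ∈ Fintype.piFinset (fun _ : Fin n => range (E i + 1)),
        if (E i = ∑ j, d j ∧ ∀ j ≠ i, E j ≤ d j) then
          a d * ∏ j ∈ univ.erase i, (((d j).choose (E j) : ℕ) : κ) * τ j ^ (d j - E j) else 0 := by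
  classical
  -- the family has zero constant coefficients, hence `HasSubst` (cf. the skeleton's `fam_hasSubst`)
  have hfam : HasSubst (fun j : Fin n => @ite (MvPowerSeries (Fin n) κ) (j = i) (Classical.dec _)
      (MvPowerSeries.X i) (MvPowerSeries.X i * (MvPowerSeries.X j + MvPowerSeries.C (τ j)))) :=
    hasSubst_of_constantCoeff_zero (fun j => by
      by_cases h : j = i
      · rw [if_pos h]; simp
      · rw [if_neg h]; simp)
  rw [coeff_subst hfam, ← finsum_comp_equiv Finsupp.equivFunOnFinite.symm]
  have key : ∀ g : Fin n → ℕ,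
      coeff (Finsupp.equivFunOnFinite.symm g) F •
        coeff E ((Finsupp.equivFunOnFinite.symm g).prod fun j e =>
          (@ite (MvPowerSeries (Fin n) κ) (j = i) (Classical.dec _) (MvPowerSeries.X i)
        (MvPowerSeries.X i * (MvPowerSeries.X j + MvPowerSeries.C (τ j)))) ^ e) =
      if (E i = ∑ j, g j ∧ ∀ j ≠ i, E j ≤ g j) then
          a g * ∏ j ∈ univ.erase i, (((g j).choose (E j) : ℕ) : κ) * τ j ^ (g j - E j) else 0 := by
    intro g
    rw [dict_coeff_prod_fam, hF, smul_eq_mul, mul_ite, mul_zero]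
    rfl
  simp_rw [key]
  apply finsum_eq_sum_of_support_subset
  intro g hg
  rw [Function.mem_support] at hg
  have hc : E i = ∑ j, g j ∧ ∀ j ≠ i, E j ≤ g j := by
    by_contra hc; exact hg (if_neg hc)
  rw [mem_coe, Fintype.mem_piFinset]
  intro j
  rw [mem_range, Nat.lt_succ_iff, hc.1]
  exact single_le_sum (f := g) (fun _ _ => Nat.zero_le _) (mem_univ j)

/-- Coefficient of `u^E` in `X_i^s * φ`. -/
theorem dict_coeff_X_pow_mul (i : Fin n) (s : ℕ) (φ : MvPowerSeries (Fin n) κ) (E : Fin n →₀ ℕ) :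
    coeff E (X i ^ s * φ) = if s ≤ E i then coeff (E - Finsupp.single i s) φ else 0 := by
  rw [X_pow_eq, coeff_monomial_mul]
  by_cases h : s ≤ E i
  · rw [if_pos (Finsupp.single_le_iff.mpr h), if_pos h, one_mul]
  · rw [if_neg (fun h' => h (Finsupp.single_le_iff.mp h')), if_neg h]

/-! ### The reindexing `D ↔ Â(D)` and the RHS coefficient formula -/

/-- `Â(D) = update (E + D) i (E i - ∑_{j ≠ i} (E j + D j))` off the chart index. -/
theorem dict_toA_ne (i : Fin n) (E : Fin n →₀ ℕ) (D : Fin n → ℕ) {j : Fin n} (h : j ≠ i) :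
    Function.update (⇑E + D) i (E i - ∑ j ∈ univ.erase i, (E j + D j)) j = E j + D j := by
  rw [Function.update_of_ne h, Pi.add_apply]

/-- **The reindexing.** The LHS box sum equals the cleaned-up `tr ∘ dv ∘ bl` sum over shifts `D`,
through the bijection `D ↦ Â(D)` between `{D | D i = 0, ∑_{j ≠ i} (E j + D j) ≤ E i}` and
`{d | |d| = E i, ∀ j ≠ i, E j ≤ d j}` (inverse `d ↦ update (d - E) i 0`). -/
theorem dict_reindex (a : (Fin n → ℕ) → κ) (i : Fin n) (τ : Fin n → κ) (E : Fin n →₀ ℕ) :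
    (∑ d ∈ Fintype.piFinset (fun _ : Fin n => range (E i + 1)),
        if (E i = ∑ j, d j ∧ ∀ j ≠ i, E j ≤ d j) then
          a d * ∏ j ∈ univ.erase i, (((d j).choose (E j) : ℕ) : κ) * τ j ^ (d j - E j) else 0) =
      ∑ D ∈ Fintype.piFinset (fun _ : Fin n => range (E i + 1)),
        if (D i = 0 ∧ ∑ j ∈ univ.erase i, (E j + D j) ≤ E i) then
          a (Function.update (⇑E + D) i (E i - ∑ j ∈ univ.erase i, (E j + D j))) *
            ∏ j ∈ univ.erase i, (((E j + D j).choose (E j) : ℕ) : κ) * τ j ^ (D j) else 0 := by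
  classical
  rw [← sum_filter, ← sum_filter]
  symm
  refine sum_nbij' (fun D => Function.update (⇑E + D) i (E i - ∑ j ∈ univ.erase i, (E j + D j)))
    (fun d => Function.update (fun j => d j - E j) i 0) ?_ ?_ ?_ ?_ ?_
  · intro D hD
    rw [mem_filter, Fintype.mem_piFinset] at hD
    obtain ⟨-, -, hS⟩ := hD
    rw [mem_filter, Fintype.mem_piFinset]
    refine ⟨fun j => ?_, ?_, fun j hj => ?_⟩
    · rw [mem_range, Nat.lt_succ_iff]
      by_cases hj : j = i
      · subst hj; rw [Function.update_self]; exact Nat.sub_le _ _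
      · rw [dict_toA_ne i E D hj]
        exact (single_le_sum (f := fun j => E j + D j) (fun _ _ => Nat.zero_le _)
          (mem_erase.mpr ⟨hj, mem_univ j⟩)).trans hS
    · rw [← add_sum_erase univ _ (mem_univ i), Function.update_self,
        sum_congr rfl (fun j hj => dict_toA_ne i E D (ne_of_mem_erase hj)), Nat.sub_add_cancel hS]
    · rw [dict_toA_ne i E D hj]; exact Nat.le_add_right _ _
  · intro d hd
    rw [mem_filter, Fintype.mem_piFinset] at hd
    obtain ⟨hbox, hsum, hle⟩ := hd
    rw [mem_filter, Fintype.mem_piFinset]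
    refine ⟨fun j => ?_, Function.update_self _ _ _, ?_⟩
    · rw [mem_range, Nat.lt_succ_iff]
      by_cases hj : j = i
      · subst hj; rw [Function.update_self]; exact Nat.zero_le _
      · rw [Function.update_of_ne hj]
        exact (Nat.sub_le _ _).trans (Nat.lt_succ_iff.mp (mem_range.mp (hbox j)))
    · rw [sum_congr rfl (fun j hj => show E j + Function.update (fun j => d j - E j) i 0 j = d j by
        rw [Function.update_of_ne (ne_of_mem_erase hj),
          Nat.add_sub_cancel' (hle j (ne_of_mem_erase hj))]), hsum]
      exact sum_le_sum_of_subset (erase_subset i univ)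
  · intro D hD
    rw [mem_filter] at hD
    obtain ⟨-, hDi, -⟩ := hD
    funext j
    by_cases hj : j = i
    · subst hj; rw [Function.update_self, hDi]
    · rw [Function.update_of_ne hj, dict_toA_ne i E D hj, Nat.add_sub_cancel_left]
  · intro d hd
    rw [mem_filter] at hd
    obtain ⟨-, hsum, hle⟩ := hd
    funext j
    by_cases hj : j = i
    · subst hj
      rw [Function.update_self, sum_congr rfl (fun k hk =>
          show E k + Function.update (fun k => d k - E k) j 0 k = d k by
            rw [Function.update_of_ne (ne_of_mem_erase hk),
              Nat.add_sub_cancel' (hle k (ne_of_mem_erase hk))]),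
        hsum, ← add_sum_erase univ _ (mem_univ j), Nat.add_sub_cancel]
    · rw [dict_toA_ne i E _ hj, Function.update_of_ne hj, Nat.add_sub_cancel' (hle j hj)]
  · intro D _
    congr 1
    refine prod_congr rfl (fun j hj => ?_)
    rw [dict_toA_ne i E D (ne_of_mem_erase hj), Nat.add_sub_cancel_left]

/-- **RHS coefficient.** The verbatim `tr i τ s (dv i s (bl i a))` sum at a state `B` with
`B i + s = E i` and `B j = E j` (`j ≠ i`), cleaned up (guards merged, `B` eliminated). -/
theorem dict_rhs (a : (Fin n → ℕ) → κ) (i : Fin n) (τ : Fin n → κ) (s : ℕ) (E : Fin n →₀ ℕ)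
    (B : Fin n → ℕ) (hBi : B i + s = E i) (hBj : ∀ j ≠ i, B j = E j) :
    Finset.sum (Fintype.piFinset (fun _ : Fin n => Finset.range (B i + s + 1)))
      (fun D => @ite κ (D i = 0) (Classical.dec _)
        (@ite κ (Finset.sum (Finset.univ.erase i)
                (fun j => (Function.update (B + D) i ((B + D) i + s)) j) ≤
              (Function.update (B + D) i ((B + D) i + s)) i) (Classical.dec _)
            (a (Function.update (Function.update (B + D) i ((B + D) i + s)) i
              ((Function.update (B + D) i ((B + D) i + s)) i -
                Finset.sum (Finset.univ.erase i)
                  (fun j => (Function.update (B + D) i ((B + D) i + s)) j))))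
            0 *
          Finset.prod (Finset.univ.erase i)
            (fun j => ((Nat.choose (B j + D j) (B j) : ℕ) : κ) * τ j ^ (D j)))
        0) =
    ∑ D ∈ Fintype.piFinset (fun _ : Fin n => range (E i + 1)),
        if (D i = 0 ∧ ∑ j ∈ univ.erase i, (E j + D j) ≤ E i) then
          a (Function.update (⇑E + D) i (E i - ∑ j ∈ univ.erase i, (E j + D j))) *
            ∏ j ∈ univ.erase i, (((E j + D j).choose (E j) : ℕ) : κ) * τ j ^ (D j) else 0 := by
  rw [hBi]
  refine sum_congr rfl (fun D _ => ?_)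
  by_cases hD : D i = 0
  · have hXi : Function.update (B + D) i ((B + D) i + s) i = E i := by
      rw [Function.update_self, Pi.add_apply, hD, add_zero, hBi]
    have hXj : ∀ j ∈ univ.erase i, Function.update (B + D) i ((B + D) i + s) j = E j + D j := by
      intro j hj
      rw [Function.update_of_ne (ne_of_mem_erase hj), Pi.add_apply, hBj j (ne_of_mem_erase hj)]
    have hupd : Function.update (B + D) i (E i - ∑ j ∈ univ.erase i, (E j + D j)) =
        Function.update (⇑E + D) i (E i - ∑ j ∈ univ.erase i, (E j + D j)) := by
      funext j
      by_cases hj : j = i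
      · subst hj; rw [Function.update_self, Function.update_self]
      · rw [Function.update_of_ne hj, dict_toA_ne i E D hj, Pi.add_apply, hBj j hj]
    have hP : ∏ j ∈ univ.erase i, (((Nat.choose (B j + D j) (B j) : ℕ) : κ) * τ j ^ (D j)) =
        ∏ j ∈ univ.erase i, (((E j + D j).choose (E j) : ℕ) : κ) * τ j ^ (D j) :=
      prod_congr rfl (fun j hj => by rw [hBj j (ne_of_mem_erase hj)])
    rw [if_pos hD, sum_congr rfl hXj, hXi, Function.update_idem, hupd, hP]
    by_cases hS : ∑ j ∈ univ.erase i, (E j + D j) ≤ E i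
    · rw [if_pos hS, if_pos ⟨hD, hS⟩]
    · rw [if_neg hS, if_neg (fun h => hS h.2), zero_mul]
  · rw [if_neg hD, if_neg (fun h => hD h.1)]

/-! ### The registered stub signature, by name (`Sig.stub_dict`, copied VERBATIM from the line
skeleton `Cruxes/NarrowRunsDie/Lines/derivlift.lean` v3; `private` so that sibling stub files can do
the same without name clashes — the statement unfolds definitionally to the skeleton's). -/

/-- Registered signature `Sig.stub_dict` of the line skeleton (VERBATIM copy): the one-blow-up
dictionary `σ_{i,τ}(Ser a) = X_i^s · Ser (tr i τ s (dv i s (bl i a)))` for a coefficient function `a`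
vanishing in total degree `< s` (blow-up chart `i`, division by `u_i^s`, translation by `τ` — the
route's lets verbatim). -/
private def Sig.stub_dict : Prop :=
  ∀ (n : ℕ) (κ : Type) [Field κ] (a : (Fin n → ℕ) → κ) (i : Fin n) (τ : Fin n → κ) (s : ℕ),
    let bl : Fin n → ((Fin n → ℕ) → κ) → ((Fin n → ℕ) → κ) := fun i c B => @ite κ (Finset.sum (Finset.univ.erase i) (fun j => B j) ≤ B i) (Classical.dec _) (c (Function.update B i (B i - Finset.sum (Finset.univ.erase i) (fun j => B j)))) 0;
    let dv : Fin n → ℕ → ((Fin n → ℕ) → κ) → ((Fin n → ℕ) → κ) := fun i s c B => c (Function.update B i (B i + s));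
    let tr : Fin n → (Fin n → κ) → ℕ → ((Fin n → ℕ) → κ) → ((Fin n → ℕ) → κ) := fun i τ s c B => Finset.sum (Fintype.piFinset (fun _ : Fin n => Finset.range (B i + s + 1))) (fun D => @ite κ (D i = 0) (Classical.dec _) (c (B + D) * Finset.prod (Finset.univ.erase i) (fun j => ((Nat.choose (B j + D j) (B j) : ℕ) : κ) * τ j ^ (D j))) 0);
    let sub : Fin n → (Fin n → κ) → MvPowerSeries (Fin n) κ → MvPowerSeries (Fin n) κ := fun i τ f => MvPowerSeries.subst (fun j : Fin n => @ite (MvPowerSeries (Fin n) κ) (j = i) (Classical.dec _) (MvPowerSeries.X i) (MvPowerSeries.X i * (MvPowerSeries.X j + MvPowerSeries.C (τ j)))) f;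
    (∀ A, a A ≠ 0 → s ≤ Finset.sum Finset.univ (fun j => A j)) →
    sub i τ (show MvPowerSeries (Fin n) κ from fun A : Fin n →₀ ℕ => a ⇑A) =
      MvPowerSeries.X i ^ s *
        (show MvPowerSeries (Fin n) κ from fun A : Fin n →₀ ℕ => tr i τ s (dv i s (bl i a)) ⇑A)

/-! ### The stub -/

/-- Stub `stub_dict` of line `derivlift` for crux `WildCones.NarrowRunsDie` (registered signature
`Sig.stub_dict`, by name; it unfolds to the skeleton's statement verbatim): THE DICTIONARY between the
route's coefficient calculus `tr ∘ dv ∘ bl` and the honest substitution `MvPowerSeries.subst`. -/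
theorem stub_dict : Sig.stub_dict := by
  intro n κ _ a i τ s bl dv tr sub hvan
  refine MvPowerSeries.ext (fun E => ?_)
  -- LHS: `sub i τ F` is `MvPowerSeries.subst fam F` by `rfl`; RHS: peel off `X_i^s`.
  have hL := dict_coeff_lhs a i τ E (show MvPowerSeries (Fin n) κ from fun A : Fin n →₀ ℕ => a ⇑A)
    (fun d => rfl)
  rw [dict_coeff_X_pow_mul]
  refine hL.trans ?_
  by_cases hs : s ≤ E i
  · rw [if_pos hs, MvPowerSeries.coeff_apply, dict_reindex]
    have hBi : (⇑(E - Finsupp.single i s) : Fin n → ℕ) i + s = E i := by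
      rw [Finsupp.coe_tsub, Pi.sub_apply, Finsupp.single_eq_same, Nat.sub_add_cancel hs]
    have hBj : ∀ j ≠ i, (⇑(E - Finsupp.single i s) : Fin n → ℕ) j = E j := by
      intro j hj
      rw [Finsupp.coe_tsub, Pi.sub_apply, Finsupp.single_eq_of_ne hj, Nat.sub_zero]
    exact (dict_rhs a i τ s E _ hBi hBj).symm
  · rw [if_neg hs]
    refine sum_eq_zero (fun d _ => ?_)
    by_cases h : E i = ∑ j, d j ∧ ∀ j ≠ i, E j ≤ d j
    · rw [if_pos h]
      rcases eq_or_ne (a d) 0 with had | had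
      · rw [had, zero_mul]
      · exact absurd ((hvan d had).trans_eq h.1.symm) hs
    · rw [if_neg h]

end Summit.ResolutionOfSingularities.ResolutionOfSingularities.Theorems.NarrowRunsDie

end
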